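import Summits.HubbardSuperconductivity.HubbardSuperconductivity.Theorems.SoloBlindFiniteVolumeCriterion
import Summits.HubbardSuperconductivity.HubbardSuperconductivity.Theorems.SoloBlindOrderNotEnergyRobust
import Literature.MathematicalPhysics.QuantumLattice.SectorGroundProjContinuity
import Literature.MathematicalPhysics.QuantumLattice.FreeFermiGasNoThermalPairFieldLRO
import HarnessLib

/-!
# The certificate (Lagrange-multiplier) form of `HubbardSuperconductivity` and the size of the multiplier

By `hubbardSuperconductivity_iff_uniform_dWave_bound` the summit asks for the order bound
`re ⟨φ, Δ_d†Δ_d φ⟩ ≥ c L⁴` on EVERY unit ground state `φ` of the doped `S^z = 0` sector `S_L` of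
`hubbardTorus 2 L 1 U`, uniformly in the even side `L` (`Δ_d` here is the tree's
`pairField dWaveFormFactor L = √2 · Σ_x Σ_e g_d(e) c c`). This file recasts that requirement as a
family of finite-dimensional operator inequalities ("certificates") and bounds
the multiplier any certificate must carry.

* `exists_multiplier_of_groundState_bound` (abstract: any Hermitian `A` with an invariant sector
  `K`, any observable `O` with `re ⟨v, O v⟩ ≥ 0`): if every unit ground vector of `A|_K` has
  `re ⟨φ, O φ⟩ ≥ a`, then for every `0 < a' < a` there is `κ ≥ 0` with
  `a' ≤ re ⟨φ, O φ⟩ + κ (re ⟨φ, A φ⟩ - minEnergyOn A K)` for ALL unit `φ ∈ K` (compactness of the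
  unit sphere of `K`; a Rayleigh-quotient minimiser on an invariant subspace is an eigenvector);
  `groundState_bound_of_multiplier` is the trivial converse.
* `hubbardSuperconductivity_iff_certificate` — **the summit is equivalent to**: `∃ U > 0`,
  `δ ∈ (0,1/2)`, `c > 0`, `L₀` such that for every even `L ≥ L₀` there is `κ_L ≥ 0` with
  `c L⁴ ≤ re ⟨φ, Δ_d†Δ_d φ⟩ + κ_L (re ⟨φ, H φ⟩ - E₀(S_L))` for every unit `φ ∈ S_L`, i.e. the
  operator inequality `P_S (Δ_d†Δ_d + κ_L (H - E₀) - c L⁴) P_S ≥ 0` — one positive-semidefiniteness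
  certificate on the sector for each large even side.
* `multiplier_mul_twistEnergy_ge` — **the multiplier is at least of order `L⁴`**: for all `t, U`,
  `c > 0`, every side `L = n+1 ≥ ⌊800/c⌋ + 4`, every joint sector `(N, S^z)` possessing a ground
  state and every `κ ≥ 0` certifying `c L⁴ ≤ re ⟨Δ_d†Δ_d⟩_φ + κ (re⟨H⟩_φ - E₀)` on the unit
  vectors `φ` of the sector:
  `(c/2) L⁴ ≤ κ · 8π²|t|(M² + M)`, `M = ⌊800/c⌋ + 1` (from `exists_twist_low_energy_small_order`: a
  twisted ground state in the sector has energy `≤ E₀ + 8π²|t|(M²+M)` and order `< (c/2) L⁴`). At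
  `t = 0` this reads `(c/2)L⁴ ≤ 0`: no certificate exists at all.
* `certificate_window_of_hubbardSuperconductivity` — both facts under the summit's own parameters.

Reading. A certificate with multiplier `κ` asserts `re ⟨Δ_d†Δ_d⟩_φ ≥ c L⁴ - κ (re⟨H⟩_φ - E₀)`; it
is vacuous for states of energy above `E₀ + 400 L⁴/κ ≤ E₀ + 800 ε/c` (the order never exceeds
`400 L⁴`, `sum_twist_pairField_order_le`) and it assigns order `≥ (c/2)L⁴` to every state of the
sector below `E₀ + c L⁴/(2κ) ≤ E₀ + ε`. So, whatever its method, a proof of the summit is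
equivalent to a statement about ALL states of the sector in an `L`-INDEPENDENT energy window above
the ground energy — the tower `[E₀, E₀ + O(|t|/c²)]`, of relative width `O(L⁻²)` on the scale of the
total energy — with energy-to-order exchange rate `κ_L ≥ (c/2ε) L⁴`. This is the quantitative form
of the obstruction of `SoloBlindOrderNotEnergyRobust`, and the resolution that certified lower-bound
(moment / sum-of-squares relaxation) methods would need at side `L`.

References: D. J. Scalapino, Phys. Rep. 250 (1995) 329, §2 (order functional); H. Tasaki,
*Physics and Mathematics of Quantum Many-Body Systems* (2020), §2.2 (variational principle in a
sector). Elementary finite-dimensional facts. [folklore]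
-/

noncomputable section

namespace Summit.HubbardSuperconductivity.HubbardSuperconductivity.Theorems

open Matrix Filter Literature.Probability.LatticeModels Literature.MathematicalPhysics.QuantumLattice
  Literature.MathematicalPhysics.QuantumLattice.EigenvalueContinuation
open scoped ComplexOrder Topology

/-! ### Abstract form: multipliers from ground-state bounds -/

section Abstract

variable {ι : Type*} [Fintype ι]

/-- **Trivial direction.** If `a ≤ re ⟨φ, O φ⟩ + κ (re ⟨φ, A φ⟩ - minEnergyOn A K)` for all unit
`φ ∈ K`, then every unit eigenvector `φ ∈ K` of `A` at the sector energy has `a ≤ re ⟨φ, O φ⟩`.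
[folklore] -/
theorem groundState_bound_of_multiplier {A O : Matrix ι ι ℂ} (K : Submodule ℂ (ι → ℂ))
    {a κ : ℝ}
    (h : ∀ φ ∈ K, star φ ⬝ᵥ φ = 1 →
      a ≤ (star φ ⬝ᵥ O *ᵥ φ).re + κ * ((star φ ⬝ᵥ A *ᵥ φ).re - A.minEnergyOn K))
    {φ : ι → ℂ} (hφK : φ ∈ K) (hφ1 : star φ ⬝ᵥ φ = 1)
    (hφA : A *ᵥ φ = ((A.minEnergyOn K : ℝ) : ℂ) • φ) : a ≤ (star φ ⬝ᵥ O *ᵥ φ).re := by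
  have hE : (star φ ⬝ᵥ A *ᵥ φ).re = A.minEnergyOn K := by
    rw [hφA, dotProduct_smul, hφ1, smul_eq_mul, mul_one, Complex.ofReal_re]
  have := h φ hφK hφ1
  rw [hE, sub_self, mul_zero, add_zero] at this
  exact this

/-- **Multipliers from ground-state bounds** (finite-dimensional compactness). Let `A` be
Hermitian with an invariant sector `K`, `O` an observable with `re ⟨v, O v⟩ ≥ 0`, and suppose every
unit `φ ∈ K` with `A φ = (minEnergyOn A K) φ` has `a ≤ re ⟨φ, O φ⟩`. Then for every `0 < a' < a`
there is `κ ≥ 0` with `a' ≤ re ⟨φ, O φ⟩ + κ (re ⟨φ, A φ⟩ - minEnergyOn A K)` for ALL unit `φ ∈ K`.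
Proof: on the compact set of unit vectors of `K` with `re ⟨φ, O φ⟩ ≤ a'` the energy attains its
minimum, which is strictly above the sector energy (a minimiser at the sector energy would be a
ground eigenvector, `mulVec_eq_smul_of_forall_le_on`); take `κ = a' / gap`. [folklore] -/
theorem exists_multiplier_of_groundState_bound {A O : Matrix ι ι ℂ} (hA : A.IsHermitian)
    (K : Submodule ℂ (ι → ℂ)) (hKA : ∀ v ∈ K, A *ᵥ v ∈ K)
    (hO : ∀ v : ι → ℂ, 0 ≤ (star v ⬝ᵥ O *ᵥ v).re) {a a' : ℝ} (ha' : 0 < a') (haa : a' < a)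
    (hgs : ∀ φ ∈ K, star φ ⬝ᵥ φ = 1 → A *ᵥ φ = ((A.minEnergyOn K : ℝ) : ℂ) • φ →
      a ≤ (star φ ⬝ᵥ O *ᵥ φ).re) :
    ∃ κ : ℝ, 0 ≤ κ ∧ ∀ φ ∈ K, star φ ⬝ᵥ φ = 1 →
      a' ≤ (star φ ⬝ᵥ O *ᵥ φ).re + κ * ((star φ ⬝ᵥ A *ᵥ φ).re - A.minEnergyOn K) := by
  classical
  set m : ℝ := A.minEnergyOn K with hm
  -- variational principle on `K`
  have hvar : ∀ v ∈ K, m * (star v ⬝ᵥ v).re ≤ (star v ⬝ᵥ A *ᵥ v).re := fun v hv =>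
    minEnergyOn_mul_le_re_rayleigh hA K hv
  have hvar1 : ∀ φ ∈ K, star φ ⬝ᵥ φ = 1 → m ≤ (star φ ⬝ᵥ A *ᵥ φ).re := by
    intro φ hφ h1
    have := hvar φ hφ
    rwa [h1, Complex.one_re, mul_one] at this
  -- the "bad" set: unit vectors of `K` with small order
  set F : Set (ι → ℂ) := {w | w ∈ K ∧ star w ⬝ᵥ w = 1} ∩ {w | (star w ⬝ᵥ O *ᵥ w).re ≤ a'} with hF
  have hFc : IsCompact F :=
    (isCompact_unitSphere_inter K).inter_right (isClosed_le (continuous_energy O) continuous_const)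
  by_cases hFne : F.Nonempty
  · obtain ⟨w₀, hw₀F, hmin⟩ := hFc.exists_isMinOn hFne (continuous_energy A).continuousOn
    have hw₀K : w₀ ∈ K := hw₀F.1.1
    have hw₀1 : star w₀ ⬝ᵥ w₀ = 1 := hw₀F.1.2
    have hw₀O : (star w₀ ⬝ᵥ O *ᵥ w₀).re ≤ a' := hw₀F.2
    set g : ℝ := (star w₀ ⬝ᵥ A *ᵥ w₀).re - m with hg
    -- the minimum energy on `F` is strictly above the sector energy
    have hgpos : 0 < g := by
      rcases (hvar1 w₀ hw₀K hw₀1).lt_or_eq with hlt | heq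
      · rw [hg]; linarith
      · exfalso
        have hle : (star w₀ ⬝ᵥ A *ᵥ w₀).re ≤ m * (star w₀ ⬝ᵥ w₀).re := by
          rw [hw₀1, Complex.one_re, mul_one, heq]
        have heig := mulVec_eq_smul_of_forall_le_on hA.eq K hKA hvar hw₀K hle
        have := hgs w₀ hw₀K hw₀1 heig
        linarith
    refine ⟨a' / g, div_nonneg ha'.le hgpos.le, fun φ hφK hφ1 => ?_⟩
    by_cases hφO : (star φ ⬝ᵥ O *ᵥ φ).re ≤ a'
    · -- `φ ∈ F`: its energy is at least `m + g`
      have hφF : φ ∈ F := ⟨⟨hφK, hφ1⟩, hφO⟩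
      have hEφ : (star w₀ ⬝ᵥ A *ᵥ w₀).re ≤ (star φ ⬝ᵥ A *ᵥ φ).re := hmin hφF
      have h1 : a' ≤ a' / g * ((star φ ⬝ᵥ A *ᵥ φ).re - m) := by
        rw [div_mul_eq_mul_div, le_div_iff₀ hgpos]
        have : g ≤ (star φ ⬝ᵥ A *ᵥ φ).re - m := by rw [hg]; linarith
        exact mul_le_mul_of_nonneg_left this ha'.le
      linarith [hO φ]
    · push Not at hφO
      have h2 : 0 ≤ a' / g * ((star φ ⬝ᵥ A *ᵥ φ).re - m) :=
        mul_nonneg (div_nonneg ha'.le hgpos.le) (by linarith [hvar1 φ hφK hφ1])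
      linarith
  · -- no bad unit vectors at all: `κ = 0`
    refine ⟨0, le_rfl, fun φ hφK hφ1 => ?_⟩
    rw [zero_mul, add_zero]
    by_contra hlt
    push Not at hlt
    exact hFne ⟨φ, ⟨hφK, hφ1⟩, hlt.le⟩

end Abstract

/-! ### Certificates for the d-wave order on the Hubbard torus -/

/-- The torus Hubbard Hamiltonian is Hermitian (no size restriction). [folklore] -/
theorem isHermitian_hubbardTorus (L : ℕ) (t U : ℝ) : (hubbardTorus 2 L t U).IsHermitian :=
  (hamiltonian_isHermitian_and_commute_holds (fermionTorusGraph 2 L) t U).1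

/-- **Certificate form of the summit.** `HubbardSuperconductivity` holds iff for some `U > 0`,
`δ ∈ (0,1/2)`, `c > 0`, `L₀`, at every even side `L = n+1 ≥ L₀` the sector
`S = (2⌊(1-δ)L²/2⌋, S^z = 0)` of `H = hubbardTorus 2 L 1 U` admits a **d-wave order certificate**
with constant `c` and some multiplier `κ ≥ 0`: every unit vector `φ ∈ S` satisfies
`c L⁴ ≤ re ⟨φ, (√2Δ_d)†(√2Δ_d) φ⟩ + κ (re ⟨φ, H φ⟩ - minEnergyOn H S)`, i.e.
`P_S ((√2Δ_d)†(√2Δ_d) + κ (H - E₀) - c L⁴) P_S ≥ 0` as an operator on the sector. [folklore] -/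
theorem hubbardSuperconductivity_iff_certificate :
    HubbardSuperconductivity ↔
      ∃ U : ℝ, 0 < U ∧ ∃ δ ∈ Set.Ioo (0 : ℝ) (1 / 2), ∃ c : ℝ, 0 < c ∧ ∃ L₀ : ℕ,
        ∀ n : ℕ, Even (n + 1) → L₀ ≤ n + 1 → ∃ κ : ℝ, 0 ≤ κ ∧
          (∀ φ ∈ szSector (Λ := FermionTorus 2 (n + 1)) (2 * ⌊(1 - δ) * ((n + 1 : ℕ) : ℝ) ^ 2 / 2⌋₊) 0, star φ ⬝ᵥ φ = 1 →
            c * ((n + 1 : ℕ) : ℝ) ^ 4 ≤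
              (expect ((pairField dWaveFormFactor (n + 1))ᴴ * pairField dWaveFormFactor (n + 1)) φ).re
                + κ * ((star φ ⬝ᵥ hubbardTorus 2 (n + 1) 1 U *ᵥ φ).re -
                    (hubbardTorus 2 (n + 1) 1 U).minEnergyOn (szSector (2 * ⌊(1 - δ) * ((n + 1 : ℕ) : ℝ) ^ 2 / 2⌋₊) 0))) := by
  rw [hubbardSuperconductivity_iff_uniform_dWave_bound]
  constructor
  · rintro ⟨U, hU, δ, hδ, c, hc, L₀, hb⟩
    refine ⟨U, hU, δ, hδ, c / 2, by positivity, L₀, fun n hn hL => ?_⟩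
    set S : Submodule ℂ (Fock (Orb (FermionTorus 2 (n + 1)))) :=
      szSector (2 * ⌊(1 - δ) * ((n + 1 : ℕ) : ℝ) ^ 2 / 2⌋₊) 0 with hS
    set O := (pairField dWaveFormFactor (n + 1))ᴴ * pairField dWaveFormFactor (n + 1) with hO
    have hpos : (0 : ℝ) < c / 2 * ((n + 1 : ℕ) : ℝ) ^ 4 := by positivity
    have hlt : c / 2 * ((n + 1 : ℕ) : ℝ) ^ 4 < c * ((n + 1 : ℕ) : ℝ) ^ 4 := by
      have : (0 : ℝ) < ((n + 1 : ℕ) : ℝ) ^ 4 := by positivity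
      nlinarith
    obtain ⟨κ, hκ, hcert⟩ := exists_multiplier_of_groundState_bound (O := O)
      (isHermitian_hubbardTorus (n + 1) 1 U) S (fun v hv => hubbardTorus_mulVec_mem_szSector 1 U hv)
      (fun v => re_expect_pairField_nonneg dWaveFormFactor n v) hpos hlt
      (fun φ hφS hφ1 hφH => hb n hn hL φ hφ1 ⟨hφS, fun h0 => by simp [h0] at hφ1, hφH⟩)
    exact ⟨κ, hκ, fun φ hφ hφ1 => hcert φ hφ hφ1⟩
  · rintro ⟨U, hU, δ, hδ, c, hc, L₀, hb⟩
    refine ⟨U, hU, δ, hδ, c, hc, L₀, fun n hn hL φ hφ1 hgs => ?_⟩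
    obtain ⟨κ, -, hcert⟩ := hb n hn hL
    exact groundState_bound_of_multiplier _ hcert hgs.1 hφ1 hgs.2.2

/-! ### The multiplier is at least of order `L⁴` -/

/-- **Any certificate has multiplier `κ ≳ L⁴`.** For all `t U : ℝ`, `c > 0`, every side
`L = n+1 ≥ ⌊800/c⌋ + 4`, every joint sector `(N, S^z = M_z)` of `hubbardTorus 2 L t U` possessing a
ground state, and every `κ ≥ 0` such that all unit vectors `φ` of the sector obey
`c L⁴ ≤ re ⟨φ, (√2Δ_d)†(√2Δ_d) φ⟩ + κ (re ⟨φ, H φ⟩ - E₀)`: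
`(c/2) L⁴ ≤ κ · 8π²|t|(M² + M)`, `M = ⌊800/c⌋ + 1` — the twisted ground state of
`exists_twist_low_energy_small_order` has energy `≤ E₀ + 8π²|t|(M²+M)` and order `< (c/2)L⁴`.
So no certificate exists at `t = 0`, and for `t ≠ 0` the certificate's content lies in the
`L`-independent energy window `[E₀, E₀ + O(|t|/c²)]` above the sector ground energy. [folklore] -/
theorem multiplier_mul_twistEnergy_ge {t U c : ℝ} (hc : 0 < c) {n : ℕ}
    (hn : ⌊800 / c⌋₊ + 4 ≤ n + 1) {N : ℕ} {Mz : ℝ} {ψ : Fock (Orb (FermionTorus 2 (n + 1)))}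
    (hψ : IsGroundStateInSector (hubbardTorus 2 (n + 1) t U) N Mz ψ) {κ : ℝ} (hκ : 0 ≤ κ)
    (hcert : (∀ φ ∈ szSector (Λ := FermionTorus 2 (n + 1)) N Mz, star φ ⬝ᵥ φ = 1 →
            c * ((n + 1 : ℕ) : ℝ) ^ 4 ≤
              (expect ((pairField dWaveFormFactor (n + 1))ᴴ * pairField dWaveFormFactor (n + 1)) φ).re
                + κ * ((star φ ⬝ᵥ hubbardTorus 2 (n + 1) t U *ᵥ φ).re -
                    (hubbardTorus 2 (n + 1) t U).minEnergyOn (szSector N Mz)))) :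
    c / 2 * ((n + 1 : ℕ) : ℝ) ^ 4 ≤
      κ * (8 * Real.pi ^ 2 * |t| * (((⌊800 / c⌋₊ + 1 : ℕ) : ℝ) ^ 2 + (⌊800 / c⌋₊ + 1 : ℕ))) := by
  classical
  -- normalise the ground state
  obtain ⟨a, ha0, -, ha1⟩ := exists_normalize hψ.2.1
  set ψ₁ : Fock (Orb (FermionTorus 2 (n + 1))) := (a : ℂ) • ψ with hψ₁
  have hψ₁gs : IsGroundStateInSector (hubbardTorus 2 (n + 1) t U) N Mz ψ₁ := by
    refine ⟨(szSector N Mz).smul_mem _ hψ.1, ?_, ?_⟩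
    · intro h0
      rw [h0] at ha1
      simp at ha1
    · rw [hψ₁, mulVec_smul, hψ.2.2, smul_comm]
  -- the twisted low-energy, small-order state (threshold `c/2`)
  set M : ℕ := ⌊800 / c⌋₊ + 1 with hM
  have hM1 : 1 ≤ M := by omega
  have hML : M < n + 1 := by omega
  obtain ⟨φ, hφS, hφ1, hE, hO⟩ := GaugeTwist.exists_twist_low_energy_small_order (L := n + 1)
    (by omega) t U hψ₁gs ha1 dWaveFormFactor GaugeTwist.abs_dWaveFormFactor_le_one hM1 hML
  -- its order is `< (c/2) L⁴`
  have hO' : (expect ((pairField dWaveFormFactor (n + 1))ᴴ * pairField dWaveFormFactor (n + 1)) φ).re <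
      c / 2 * ((n + 1 : ℕ) : ℝ) ^ 4 := by
    refine hO.trans_lt ?_
    have hcM : 800 / c < M := by rw [hM]; push_cast; exact Nat.lt_floor_add_one _
    have hn4 : (0 : ℝ) < ((n + 1 : ℕ) : ℝ) ^ 4 := by positivity
    have hM0 : (0 : ℝ) < M := by exact_mod_cast hM1
    rw [div_lt_iff₀ hM0]
    rw [div_lt_iff₀ hc] at hcM
    push_cast at hn4 ⊢
    nlinarith [mul_lt_mul_of_pos_right hcM hn4]
  -- plug it into the certificate
  have hc' := hcert φ hφS hφ1
  have hEd : (star φ ⬝ᵥ hubbardTorus 2 (n + 1) t U *ᵥ φ).re -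
      (hubbardTorus 2 (n + 1) t U).minEnergyOn (szSector N Mz) ≤
        8 * Real.pi ^ 2 * |t| * ((M : ℝ) ^ 2 + M) := by linarith
  have hκE := mul_le_mul_of_nonneg_left hEd hκ
  linarith

/-- **The certificate window of the summit.** If `HubbardSuperconductivity` holds then there are
`U > 0`, `δ ∈ (0,1/2)`, `c > 0`, `L₀` such that at every even side `L = n+1 ≥ L₀` the doped
`S^z = 0` sector admits a d-wave order certificate with constant `c`, AND every multiplier
`κ ≥ 0` of such a certificate satisfies `(c/2) L⁴ ≤ κ · 8π²(M²+M)`, `M = ⌊800/c⌋ + 1`: the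
energy-to-order exchange rate of any proof is at least `(c/(16π²(M²+M))) · L⁴`. [folklore] -/
theorem certificate_window_of_hubbardSuperconductivity (h : HubbardSuperconductivity) :
    ∃ U : ℝ, 0 < U ∧ ∃ δ ∈ Set.Ioo (0 : ℝ) (1 / 2), ∃ c : ℝ, 0 < c ∧ ∃ L₀ : ℕ,
      ∀ n : ℕ, Even (n + 1) → L₀ ≤ n + 1 →
        (∃ κ : ℝ, 0 ≤ κ ∧ (∀ φ ∈ szSector (Λ := FermionTorus 2 (n + 1)) (2 * ⌊(1 - δ) * ((n + 1 : ℕ) : ℝ) ^ 2 / 2⌋₊) 0, star φ ⬝ᵥ φ = 1 →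
            c * ((n + 1 : ℕ) : ℝ) ^ 4 ≤
              (expect ((pairField dWaveFormFactor (n + 1))ᴴ * pairField dWaveFormFactor (n + 1)) φ).re
                + κ * ((star φ ⬝ᵥ hubbardTorus 2 (n + 1) 1 U *ᵥ φ).re -
                    (hubbardTorus 2 (n + 1) 1 U).minEnergyOn (szSector (2 * ⌊(1 - δ) * ((n + 1 : ℕ) : ℝ) ^ 2 / 2⌋₊) 0)))) ∧
        ∀ κ : ℝ, 0 ≤ κ → (∀ φ ∈ szSector (Λ := FermionTorus 2 (n + 1)) (2 * ⌊(1 - δ) * ((n + 1 : ℕ) : ℝ) ^ 2 / 2⌋₊) 0, star φ ⬝ᵥ φ = 1 →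
            c * ((n + 1 : ℕ) : ℝ) ^ 4 ≤
              (expect ((pairField dWaveFormFactor (n + 1))ᴴ * pairField dWaveFormFactor (n + 1)) φ).re
                + κ * ((star φ ⬝ᵥ hubbardTorus 2 (n + 1) 1 U *ᵥ φ).re -
                    (hubbardTorus 2 (n + 1) 1 U).minEnergyOn (szSector (2 * ⌊(1 - δ) * ((n + 1 : ℕ) : ℝ) ^ 2 / 2⌋₊) 0))) →
          c / 2 * ((n + 1 : ℕ) : ℝ) ^ 4 ≤
            κ * (8 * Real.pi ^ 2 * (((⌊800 / c⌋₊ + 1 : ℕ) : ℝ) ^ 2 + (⌊800 / c⌋₊ + 1 : ℕ))) := by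
  obtain ⟨U, hU, δ, hδ, c, hc, L₀, hb⟩ := hubbardSuperconductivity_iff_certificate.1 h
  refine ⟨U, hU, δ, hδ, c, hc, max L₀ (⌊800 / c⌋₊ + 4), fun n hn hL => ⟨hb n hn (le_of_max_le_left hL), ?_⟩⟩
  intro κ hκ hcert
  obtain ⟨ψ, -, hψ⟩ :=
    InfVolFermionState.exists_unit_isGroundStateInSector_rectN (1 : ℝ) U (n := 1 - δ)
      (by linarith [hδ.1]) (n + 1)
  have hψ' : IsGroundStateInSector (hubbardTorus 2 (n + 1) 1 U)
      (2 * ⌊(1 - δ) * ((n + 1 : ℕ) : ℝ) ^ 2 / 2⌋₊) 0 ψ := by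
    simpa [ThermodynamicLimit.rectN] using hψ
  have := multiplier_mul_twistEnergy_ge (t := 1) hc (le_of_max_le_right hL) hψ' hκ hcert
  simpa using this

end Summit.HubbardSuperconductivity.HubbardSuperconductivity.Theorems

end
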